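import Summits.NavierStokesRegularity.NavierStokesRegularity.Theorems.ClockStretchingLawClockLaw
import Summits.NavierStokesRegularity.NavierStokesRegularity.Theorems.ClockStretchingLawClockCeilingLerayFloor
import HarnessLib

/-!
# Route `ClockStretchingLaw`, crux `ClockCeiling` (stmt-NavierStokesRegularity-10570): the FAR-PAST
# RECENTRED CLOCK FLOOR of nonzero Type-I ancient elements — portrait of a counterexample

Line `registered` of the crux, lead c6, `--supports` file, stub `stub_farPastClockFloor`.

The crux reads the clock amplitude `a_u(t) = (−t)^{3/2} ∫ ‖∂ₜu(t,x)‖² e^{−‖x‖²/(4(−t))} dx` of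
the elements of the Type-I ancient class `A_C` (`IsTypeIAncientMild C u`: smooth, divergence-free,
KNSS-mild ancient fields on `ℝ³ × (−∞,0)` with `‖u(t,x)‖ ≤ C/√(−t)`). The all-time clock law
(`stub_uniformClockLaw`) is a floor for SINGULAR elements at every `t < 0`. This file is the dual
clause at the other end of time, for merely NONZERO elements and in the crux's own currency:

* `stub_farPastClockFloor` — **for every `C` there is `δ = δ(C) > 0` such that every nonzero
  `u ∈ A_C` has a far end `t < T(u) < 0` on which the clock RECENTRED at a suitable point
  `x₀ = x₀(t)` reads `(−t)^{3/2} ∫ ‖∂ₜu(t,x)‖² e^{−‖x − x₀‖²/(4(−t))} dx ≥ δ`.**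

So a nonzero Type-I ancient element is never asymptotically steady at its own scale as `t → −∞`.

Proof: if not, nonzero `u_k ∈ A_C` have, arbitrarily far in the past, instants `t_k` at which
the clock centred at EVERY point is `< 1/(k+1)`; by the far-past amplitude floor
(`farPastAmplitudeFloor`: `√(−t)‖u(t, ·)‖_∞ > 1/(32C₀)` on a whole far end of a nonzero element) we
may take `t_k` on that end and a floor point `x_k`. The zoom recentred at `(0, x_k)` with scale
`c_k = √(−t_k)`, `v_k(s,y) = c_k u_k(c_k² s, x_k + c_k y)`, stays in `A_C`
(`isTypeIAncientMild_zoom`), has `‖v_k(−1, 0)‖ = √(−t_k)‖u_k(t_k, x_k)‖ > 1/(32C₀)` and clock at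
`s = −1` centred at the origin equal to the clock of `u_k` at `t_k` centred at `x_k`
(`farPastClock_zoom`), hence `< 1/(k+1)`. KNSS compactness of the class on growing windows
(`exists_tendsto_of_typeI_seq_Ioo`) extracts a pointwise limit `W ∈ A_C`; the amplitudes converge
(`stub_clockSlice` (iii)), so the clock of `W` at `−1` vanishes, `∂ₜW(−1, ·) ≡ 0`
(`stub_clockSlice` (ii)), and ONE steady slice kills a Type-I KNSS-mild field
(`SteadySliceLiouville`, `clockLaw_eq_zero_of_steady_slice`): `W ≡ 0` — contradicting
`‖W(−1, 0)‖ ≥ 1/(32C₀)`.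

## References

* G. Koch, N. Nadirashvili, G. Seregin, V. Šverák, Acta Math. 203 (2009) = arXiv:0709.3599, §1 (1.2),
  Lemma 6.1, Prop. 4.1, §6. [KochNadirashviliSereginSverak2009]
* H. Dong, Q. S. Zhang, J. Funct. Anal. 279 (2020) 108563 = arXiv:1907.01687, Thm. 2 (time
  analyticity behind `SteadySliceLiouville`). [DongZhang2020]
-/

noncomputable section

open MeasureTheory Filter Topology Set Metric Function
open scoped NNReal ENNReal

-- `Summit = Problem` namespace duplication is the tree's layout (CONVENTIONS §1); as in every Theorems file.
set_option linter.dupNamespace false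

namespace Summit.NavierStokesRegularity.NavierStokesRegularity.Theorems

open Literature.Analysis Literature.Analysis.FluidPDE
open Summit.NavierStokesRegularity.NavierStokesRegularity.Theorems.ClockLaw.Birth

/-! ### The recentred zoom and its clock -/

/-- **The clock mode of the recentred zoom**: for `v = c • stPull (c²) c 0 x₀ u`,
`v(s, y) = c u(c²s, x₀ + c y)`, one has `∂ₛv(s, y) = c³ ∂ₜu(c²s, x₀ + c y)` (chain rule in time;
unconditional, both sides being junk `0` together). -/
theorem farPastClock_timeDeriv_zoom (u : ℝ → EuclideanSpace ℝ (Fin 3) → EuclideanSpace ℝ (Fin 3))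
    (c : ℝ) (x₀ : EuclideanSpace ℝ (Fin 3)) (s : ℝ) (y : EuclideanSpace ℝ (Fin 3)) :
    timeDeriv (c • stPull (c ^ 2) c 0 x₀ u) s y =
      (c * c ^ 2) • timeDeriv u (c ^ 2 * s) (x₀ + c • y) := by
  have e1 : timeDeriv (c • stPull (c ^ 2) c 0 x₀ u) s y =
      c • timeDeriv (stPull (c ^ 2) c 0 x₀ u) s y := by
    simp only [timeDeriv_apply, Pi.smul_apply]
    exact deriv_fun_const_smul_field c _
  rw [e1, timeDeriv_stPull, zero_add, smul_smul]

/-- **Recentred parabolic covariance of the clock amplitude**: for `c > 0`, `s < 0` and any centre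
`x₀`, the clock of the zoom `v = c • stPull (c²) c 0 x₀ u` at time `s` centred at the origin equals
the clock of `u` at time `c²s` centred at `x₀`:
`(−s)^{3/2} ∫ ‖∂ₛv(s,y)‖² e^{−‖y‖²/(4(−s))} dy
  = (−c²s)^{3/2} ∫ ‖∂ₜu(c²s,x)‖² e^{−‖x − x₀‖²/(4(−c²s))} dx`
(`∂ₛv = c³∂ₜu`, substitution `x = x₀ + c y`, `(c²)^{3/2} = c³`). -/
theorem farPastClock_zoom (u : ℝ → EuclideanSpace ℝ (Fin 3) → EuclideanSpace ℝ (Fin 3)) {c : ℝ}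
    (hc : 0 < c) (x₀ : EuclideanSpace ℝ (Fin 3)) {s : ℝ} (hs : s < 0) :
    (-s) ^ ((3 : ℝ) / 2) *
        ∫ y, ‖timeDeriv (c • stPull (c ^ 2) c 0 x₀ u) s y‖ ^ 2 *
          Real.exp (-(‖y‖ ^ 2) / (4 * (-s))) =
      (-(c ^ 2 * s)) ^ ((3 : ℝ) / 2) *
        ∫ x, ‖timeDeriv u (c ^ 2 * s) x‖ ^ 2 *
          Real.exp (-(‖x - x₀‖ ^ 2) / (4 * (-(c ^ 2 * s)))) := by
  set G := fun x => ‖timeDeriv u (c ^ 2 * s) x‖ ^ 2 *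
    Real.exp (-(‖x - x₀‖ ^ 2) / (4 * (-(c ^ 2 * s)))) with hG
  have hpt : ∀ y, ‖timeDeriv (c • stPull (c ^ 2) c 0 x₀ u) s y‖ ^ 2 *
      Real.exp (-(‖y‖ ^ 2) / (4 * (-s))) = c ^ 6 * G (x₀ + c • y) := by
    intro y
    rw [farPastClock_timeDeriv_zoom, norm_smul, hG]
    dsimp only
    rw [add_sub_cancel_left, norm_smul, Real.norm_of_nonneg hc.le,
      Real.norm_of_nonneg (by positivity : (0 : ℝ) ≤ c * c ^ 2)]
    have hs0 : s ≠ 0 := hs.ne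
    have e : -((c * ‖y‖) ^ 2) / (4 * -(c ^ 2 * s)) = -(‖y‖ ^ 2) / (4 * -s) := by
      field_simp
    rw [e]
    ring
  have hI : ∫ y, ‖timeDeriv (c • stPull (c ^ 2) c 0 x₀ u) s y‖ ^ 2 *
      Real.exp (-(‖y‖ ^ 2) / (4 * (-s))) = ∫ y, c ^ 6 * G (x₀ + c • y) :=
    integral_congr_ae (Eventually.of_forall hpt)
  rw [hI, integral_const_mul, integral_comp_space_affine hc x₀ G, finrank_euclideanSpace_fin,
    smul_eq_mul]
  have hr : (-(c ^ 2 * s)) ^ ((3 : ℝ) / 2) = c ^ 3 * (-s) ^ ((3 : ℝ) / 2) := by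
    rw [show -(c ^ 2 * s) = c ^ 2 * -s by ring, Real.mul_rpow (by positivity) (by linarith)]
    congr 1
    rw [← Real.rpow_natCast c 2, ← Real.rpow_mul hc.le, ← Real.rpow_natCast c 3]
    norm_num
  have hc3 : c ^ 3 ≠ 0 := by positivity
  rw [hr, ← mul_assoc, ← mul_assoc,
    show (-s) ^ ((3 : ℝ) / 2) * c ^ 6 = c ^ 3 * (-s) ^ ((3 : ℝ) / 2) * c ^ 3 by ring,
    mul_inv_cancel_right₀ hc3]

/-! ### The far-past recentred clock floor -/

/-- **Stub `stub_farPastClockFloor` (portrait clause of crux `ClockCeiling`, line `registered`):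
THE FAR-PAST RECENTRED CLOCK FLOOR OF NONZERO ELEMENTS.** For every `C` there is `δ = δ(C) > 0`
such that every NONZERO element `u` of the Type-I ancient class `A_C` admits `T < 0` with: for
every `t < T` some centre `x₀` has
`(−t)^{3/2} ∫ ‖∂ₜu(t,x)‖² e^{−‖x − x₀‖²/(4(−t))} dx ≥ δ` — a nonzero Type-I ancient element is never
asymptotically steady at its own scale as `t → −∞`. (Contradiction: recentred zoom-outs along the
far-past amplitude floor `farPastAmplitudeFloor`, class invariance `isTypeIAncientMild_zoom` and
clock covariance `farPastClock_zoom`, KNSS compactness `exists_tendsto_of_typeI_seq_Ioo`,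
convergence of amplitudes and "a zero of the clock is a steady instant" `stub_clockSlice`, and the
proved `SteadySliceLiouville` through `clockLaw_eq_zero_of_steady_slice`.)
[cite: KochNadirashviliSereginSverak2009, §1 (1.2), Lemma 6.1 and Prop. 4.1 (arXiv:0709.3599 pp. 2, 8, 11)] -/
theorem stub_farPastClockFloor : ∀ C : ℝ, ∃ δ > 0, ∀ u : ℝ → EuclideanSpace ℝ (Fin 3) → EuclideanSpace ℝ (Fin 3), Literature.Analysis.FluidPDE.IsTypeIAncientMild C u → (∃ t < 0, ∃ x, u t x ≠ 0) → ∃ T < 0, ∀ t < T, ∃ x₀ : EuclideanSpace ℝ (Fin 3), δ ≤ (-t) ^ ((3 : ℝ) / 2) * ∫ x, ‖Literature.Analysis.FluidPDE.timeDeriv u t x‖ ^ 2 * Real.exp (-(‖x - x₀‖ ^ 2) / (4 * (-t))) := by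
  intro C
  by_contra h
  push Not at h
  -- nonzero elements whose recentred clocks dip below `1/(n+1)` arbitrarily far in the past
  have hseq : ∀ n : ℕ, ∃ u : ℝ → EuclideanSpace ℝ (Fin 3) → EuclideanSpace ℝ (Fin 3),
      IsTypeIAncientMild C u ∧ (∃ t < 0, ∃ x, u t x ≠ 0) ∧
      ∀ T < 0, ∃ t < T, ∀ x₀ : EuclideanSpace ℝ (Fin 3), (-t) ^ ((3 : ℝ) / 2) *
        ∫ x, ‖timeDeriv u t x‖ ^ 2 * Real.exp (-(‖x - x₀‖ ^ 2) / (4 * (-t))) <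
          1 / ((n : ℝ) + 1) := fun n => by
    obtain ⟨u, hu, hne, hlt⟩ := h _ Nat.one_div_pos_of_nat
    exact ⟨u, hu, hne, hlt⟩
  choose u hu hne hsmall using hseq
  -- the far-past amplitude floor: a far end `(-∞, T n)` of each `u n`
  have hT' : ∀ n, ∃ T < 0, ∀ t < T, ∃ x,
      1 < 32 * oseenSliceConst (EuclideanSpace ℝ (Fin 3)) * (Real.sqrt (-t) * ‖u n t x‖) :=
    fun n => farPastAmplitudeFloor (hu n) (hne n)
  choose T hT0 hT using hT'
  -- instants `τ n < T n` with small recentred clocks, and floor points `ξ n`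
  have hτ' : ∀ n, ∃ t < T n, ∀ x₀ : EuclideanSpace ℝ (Fin 3), (-t) ^ ((3 : ℝ) / 2) *
      ∫ x, ‖timeDeriv (u n) t x‖ ^ 2 * Real.exp (-(‖x - x₀‖ ^ 2) / (4 * (-t))) <
        1 / ((n : ℝ) + 1) := fun n => hsmall n (T n) (hT0 n)
  choose τ hτT hlt using hτ'
  have hτ0 : ∀ n, τ n < 0 := fun n => (hτT n).trans (hT0 n)
  have hξ' : ∀ n, ∃ x, 1 < 32 * oseenSliceConst (EuclideanSpace ℝ (Fin 3)) *
      (Real.sqrt (-(τ n)) * ‖u n (τ n) x‖) := fun n => hT n (τ n) (hτT n)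
  choose ξ hξ using hξ'
  -- the scales `c n = √(-τ n)` and the recentred zooms `v n`
  obtain ⟨c, hc_def⟩ : ∃ c : ℕ → ℝ, ∀ n, c n = Real.sqrt (-(τ n)) := ⟨_, fun n => rfl⟩
  have hcpos : ∀ n, 0 < c n := fun n => by rw [hc_def]; exact Real.sqrt_pos.2 (neg_pos.2 (hτ0 n))
  have hcsq : ∀ n, c n ^ 2 = -(τ n) := fun n => by
    rw [hc_def]; exact Real.sq_sqrt (neg_nonneg.2 (hτ0 n).le)
  obtain ⟨v, hv_def⟩ : ∃ v : ℕ → ℝ → EuclideanSpace ℝ (Fin 3) → EuclideanSpace ℝ (Fin 3),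
      ∀ n, v n = c n • stPull (c n ^ 2) (c n) 0 (ξ n) (u n) := ⟨_, fun n => rfl⟩
  have hv : ∀ n, IsTypeIAncientMild C (v n) := fun n => by
    rw [hv_def]; exact isTypeIAncientMild_zoom (hu n) (hcpos n) (ξ n)
  -- the unit-scale values `v n (-1) 0` stay above the Leray floor
  have hval : ∀ n, 1 < 32 * oseenSliceConst (EuclideanSpace ℝ (Fin 3)) * ‖v n (-1) 0‖ := by
    intro n
    have e : v n (-1) 0 = c n • u n (τ n) (ξ n) := by
      rw [hv_def, zoom_apply, smul_zero, add_zero, mul_neg_one, hcsq, neg_neg]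
    rw [e, norm_smul, Real.norm_of_nonneg (hcpos n).le, hc_def]
    exact hξ n
  -- the clocks of `v n` at `-1` centred at the origin dip below `1/(n+1)`
  have hclock : ∀ n, (-(-1 : ℝ)) ^ ((3 : ℝ) / 2) *
      ∫ y, ‖timeDeriv (v n) (-1) y‖ ^ 2 * Real.exp (-(‖y‖ ^ 2) / (4 * (-(-1 : ℝ)))) <
        1 / ((n : ℝ) + 1) := by
    intro n
    rw [hv_def, farPastClock_zoom (u n) (hcpos n) (ξ n) (by norm_num : (-1 : ℝ) < 0)]
    have e2 : c n ^ 2 * (-1 : ℝ) = τ n := by rw [hcsq]; ring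
    rw [e2]
    exact hlt n (ξ n)
  -- compactness of the class on the growing windows `(-(k+1), 0)`
  set A : ℕ → ℝ := fun k => -((k : ℝ) + 1) with hA
  have hAt : Tendsto A atTop atBot :=
    tendsto_neg_atTop_atBot.comp (tendsto_natCast_atTop_atTop.atTop_add tendsto_const_nhds)
  have hcont : ∀ k, ContinuousOn (uncurry (v k)) (Ioo (A k) 0 ×ˢ univ) := fun k =>
    (hv k).continuousOn_uncurry.mono (prod_mono (fun t ht => ht.2) subset_rfl)
  have hdivw : ∀ k, ∀ t ∈ Ioo (A k) 0, IsWeaklyDivFree (v k t) := fun k t ht =>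
    (hv k).isWeaklyDivFree ht.2
  have hmild : ∀ k, ∀ s t : ℝ, A k < s → s < t → t < 0 → ∀ x,
      v k t x = UnboundedOperators.heatExtension (v k s) (t - s) x -
        oseenDuhamel 1 s (v k) (v k) t x :=
    fun k s t _ hst ht x => (hv k).mild_eq_heatExtension hst ht x
  have hI : ∀ k, ∀ t ∈ Ioo (A k) 0, ∀ x, ‖v k t x‖ ≤ C / Real.sqrt (-t) := fun k t ht x =>
    (hv k).norm_le ht.2 x
  obtain ⟨φ, hφ, W, hW, hpt, -, -, -⟩ :=
    exists_tendsto_of_typeI_seq_Ioo C hAt hcont hdivw hmild hI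
  -- the clocks at `-1` converge, to a limit `≤ 0`, hence `= 0`: a steady slice of `W`
  obtain ⟨-, hsteady0, hconv, -⟩ := stub_clockSlice stub_timeDerivBounds
  have hlimA := hconv C (fun j => v (φ j)) W (fun j => hv (φ j)) hW hpt (-1) (by norm_num)
  have hb : Tendsto (fun j : ℕ => 1 / ((φ j : ℝ) + 1)) atTop (𝓝 0) :=
    (tendsto_one_div_add_atTop_nhds_zero_nat (𝕜 := ℝ)).comp hφ.tendsto_atTop
  have hle : (-(-1 : ℝ)) ^ ((3 : ℝ) / 2) *
      ∫ y, ‖timeDeriv W (-1) y‖ ^ 2 * Real.exp (-(‖y‖ ^ 2) / (4 * (-(-1 : ℝ)))) ≤ 0 :=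
    le_of_tendsto_of_tendsto' hlimA hb fun j => (hclock (φ j)).le
  have hzeroA : (-(-1 : ℝ)) ^ ((3 : ℝ) / 2) *
      ∫ y, ‖timeDeriv W (-1) y‖ ^ 2 * Real.exp (-(‖y‖ ^ 2) / (4 * (-(-1 : ℝ)))) = 0 :=
    le_antisymm hle (clockLaw_amp_nonneg W (by norm_num))
  have hsteady : ∀ y, timeDeriv W (-1) y = 0 := hsteady0 C W hW (-1) (by norm_num) hzeroA
  -- one steady slice kills a Type-I KNSS-mild field (`SteadySliceLiouville`)
  have hWzero := clockLaw_eq_zero_of_steady_slice hW (by norm_num : (-1 : ℝ) < 0) hsteady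
  -- but the unit-scale values persist in the limit
  have hlimv : Tendsto (fun j => 32 * oseenSliceConst (EuclideanSpace ℝ (Fin 3)) * ‖v (φ j) (-1) 0‖)
      atTop (𝓝 (32 * oseenSliceConst (EuclideanSpace ℝ (Fin 3)) * ‖W (-1) 0‖)) :=
    ((hpt (-1) (by norm_num) 0).norm).const_mul _
  have hge : 1 ≤ 32 * oseenSliceConst (EuclideanSpace ℝ (Fin 3)) * ‖W (-1) 0‖ :=
    ge_of_tendsto' hlimv fun j => (hval (φ j)).le
  rw [hWzero (-1) (by norm_num) 0, norm_zero, mul_zero] at hge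
  exact absurd hge (by norm_num)

end Summit.NavierStokesRegularity.NavierStokesRegularity.Theorems

end
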